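import Literature.AnabelianGeometry.EtaleTheta.Discharge.Sec4Thm44SelfEquivalenceOfConnectedTemperoid
import Literature.AnabelianGeometry.EtaleTheta.Discharge.Sec4BaseShapeOfConnectedTemperoid
import Literature.AnabelianGeometry.EtaleTheta.BiKummerThm44SubModelConnectedOfGaloisCoveringCoset
import Literature.AnabelianGeometry.EtaleTheta.BiKummerThm44SubModelConnectedOfGaloisCovering

/-!
# [EtTh] Thm. 4.4 for a SELF-EQUIVALENCE `Ψ : C ⥲ C` over the genuine base, at the CONSTRUCTED Def 3.3 (iii) data on the
# coset model of `D₀` (and on the connected model): the binder `hBinj` DROPS (proof-only)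

S. Mochizuki, *The étale theta function and its Frobenioid-theoretic manifestations*, Publ. RIMS **45** (2009)
[MochizukiEtTh2009], Thm 4.4 pp.319–320 (PDF pp.93–94); Prop 5.1 p.323 (PDF p.97) («`C` and `Ψ` satisfy the hypotheses of
Theorem 4.4»).  abc-iut cell, layer L2, SUBDAG-EtTh-Thm44 (custodian lineage abc-iut-w5-d179).  Seat abc-iut-w5-d179 (gen 5).
PROOF-ONLY (0 `def`s, no `Prop` facts, no instances); abc-iut-w4-d008's `exists_thm44Hyp_self_of_hBinj` /
`exists_thm44_self_mkOfConnectedTemperoid` (R251, `Sec4Thm44SelfEquivalenceOfConnectedTemperoid.lean`, p443466) and this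
lineage's `hBinj` theorems at the coset / connected constructed data (p443031 §0 / p439044 §0) are consumed BY NAME.

WHAT THIS FILE PROVES.  For ANY tempered Frobenioid `C` over the strong `Λ = ℤ` Def 3.6 (i) data `ofRlfZ … hpf` of
abc-iut-w6-d058's constructed Def 3.3 (iii) data — on the SMALL coset model `DivisorMonoids.ofGaloisActionCoset A hZ`
(base field `K : Type u`) or on the connected model `ofGaloisActionConnected A hZ` (`K : Type (u+1)`) — and EVERY
self-equivalence `Ψ : C ⥲ C` over `B^temp(Π^tp_X)⁰`:
* `exists_thm44Hyp_self_ofGaloisActionCoset` / `…Connected`: the hypothesis package `Thm44Hyp S S` with underlying `Ψ`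
  EXISTS ⇐ {`hnd` («`Φ` non-dilating»), `hshape` («`D = D₀[𝒟]`»), `hc : IsTopCharacteristic Π^tp_X H_⊙`} — `hBinj` dropped;
* `exists_thm44_self_mkOfConnectedTemperoid_ofGaloisActionCoset` / `…Connected`: and it satisfies T44-L03, T44-L09, T44-L09c,
  T44-L08, Thm 4.4 (i), and — given T44-L15b — Thm 4.4 (ii) ∧ (iii) ∧ (`N`-th roots).
Residual binders at the constructed data: {`hnd`, `hshape`, `hc`, T44-L15b} (+ the printed perf-factorial slot `hpf` as the
constructor's parameter; the weak-vocabulary twin waits for a weak `Sec4Thm44SelfEquivalence…`).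
HONEST FRAMING: refereed pre-IUT material; every theorem is an implication for data so parametrised (`LogDivisorModel` /
`GaloisAction` / `CuspLaws` are interface and parameter records — nothing asserts they arise from an actual curve; NV of the
quantified class of tempered Frobenioids over constructed data: cell finding F-w6d048g3-1, lifts with abc-iut-w6-d058's
`LogDivisorModelTateTower`); nothing here bears on the disputed [IUTchIII] Cor. 3.12; typed ≠ proved — here PROVED.
-/

noncomputable section

namespace Literature.AnabelianGeometry.EtaleTheta

open CategoryTheory Opposite Function Literature.AlgebraicGeometry.Frobenioids Literature.AnabelianGeometry.SemiGraphs

namespace BiKummerSetting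

open LogDivisorModel.GaloisAction

universe u

/-! ### §1 Over the coset model (`K : Type u`) -/

section Coset

variable {Z : LogDivisorModel.{u}} {G : Type u} [Group G] (GA : Z.GaloisAction G) (hC : Z.CuspLaws)
  (hpf : ∀ Y : (InducedCategory (Action (Type u) G) (cosetGSet G))ᵒᵖ,
    IsPerfFactorial ((DivisorMonoids.ofGaloisActionCoset GA hC).Φ₀.obj Y))
  {K : Type u} [Field K] (X : SemiGraphs.TemperedArithmeticGroup.{u} K)
  {IsRational IsStrictlyRational : ((ConnectedPart (BTemp X.Pi))ᵒᵖ ⥤ CommMonCat.{u}) → Prop}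
  (C : TemperedFrobenioid (RealifiedDivisorMonoids.ofRlfZ (DivisorMonoids.ofGaloisActionCoset GA hC) hpf)
    (ConnectedPart (BTemp X.Pi)) (treeCatVocab (ConnectedPart (BTemp X.Pi)) IsRational IsStrictlyRational))
  (hZ : C.monoidType = MonoidType.Z) (hP : ∀ A : (ConnectedPart (BTemp X.Pi))ᵒᵖ, IsPerfect (C.Φ.carrier A))
  (NH : Subgroup (Field.absoluteGaloisGroup K) → C.category → ℕ+ → Prop) (A₀ : C.category)
  (hA₀ : PreFrobenioid.IsFrobeniusTrivial C.toElem A₀) (hA₀' : SemiGraphs.IsGaloisObj A₀.base.obj)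

/-- **Prop 5.1's pin at the coset-model constructed data**: for EVERY self-equivalence `Ψ : C ⥲ C`, `Thm44Hyp S S` with
underlying `Ψ` EXISTS ⇐ {`hnd`, `hshape`, `hc`} — abc-iut-w4-d008's `exists_thm44Hyp_self_of_hBinj` with `hBinj` DISCHARGED
(`ofGaloisActionCoset_ofRlfZ_hBinj`). [cite: MochizukiEtTh2009, Prop 5.1 p.323 (PDF p.97)] -/
theorem exists_thm44Hyp_self_ofGaloisActionCoset
    (hnd : ∀ (A : (ConnectedPart (BTemp X.Pi))ᵒᵖ) (f : A ⟶ A), treeMonoidVocab.{u}.IsNonDilating (C.Φ.carrier A) (C.Φ.pull f))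
    (hshape : C.base.Full ∧ C.base.Faithful ∧
      ∃ 𝒟 : InducedCategory (Action (Type u) G) (cosetGSet G), ∀ Y : InducedCategory (Action (Type u) G) (cosetGSet G),
        (∃ A : ConnectedPart (BTemp X.Pi), Nonempty (C.base.obj A ≅ Y)) ↔ Nonempty (Y ⟶ 𝒟))
    (hc : IsTopCharacteristic X.Pi (mkOfConnectedTemperoid X C hZ hP NH A₀ hA₀ hA₀').Hodot)
    (Ψ : C.category ≌ C.category) :
    ∃ hh : Thm44Hyp (mkOfConnectedTemperoid X C hZ hP NH A₀ hA₀ hA₀') (mkOfConnectedTemperoid X C hZ hP NH A₀ hA₀ hA₀'),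
      hh.Ψ = Ψ :=
  exists_thm44Hyp_self_of_hBinj X C hZ hP NH A₀ hA₀ hA₀' (DivisorMonoids.ofGaloisActionCoset_ofRlfZ_hBinj GA hC hpf) hnd
    hshape hc Ψ

/-- **[EtTh] Thm 4.4 for EVERY self-equivalence `Ψ : C ⥲ C` at the coset-model constructed data**: a package `hh : Thm44Hyp S S`
with `hh.Ψ = Ψ` exists and satisfies T44-L03, T44-L09, T44-L09c, T44-L08, Thm 4.4 (i), and — given T44-L15b and any proofs for
the ψ-slot — Thm 4.4 (ii) ∧ (iii) ∧ (`N`-th roots); residual = {`hnd`, `hshape`, `hc`, T44-L15b} (abc-iut-w4-d008's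
`exists_thm44_self_mkOfConnectedTemperoid` with `hBinj` DISCHARGED). [cite: MochizukiEtTh2009, Thm 4.4 p.319–320 (PDF pp.93–94)] -/
theorem exists_thm44_self_mkOfConnectedTemperoid_ofGaloisActionCoset
    (hnd : ∀ (A : (ConnectedPart (BTemp X.Pi))ᵒᵖ) (f : A ⟶ A), treeMonoidVocab.{u}.IsNonDilating (C.Φ.carrier A) (C.Φ.pull f))
    (hshape : C.base.Full ∧ C.base.Faithful ∧
      ∃ 𝒟 : InducedCategory (Action (Type u) G) (cosetGSet G), ∀ Y : InducedCategory (Action (Type u) G) (cosetGSet G),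
        (∃ A : ConnectedPart (BTemp X.Pi), Nonempty (C.base.obj A ≅ Y)) ↔ Nonempty (Y ⟶ 𝒟))
    (hc : IsTopCharacteristic X.Pi (mkOfConnectedTemperoid X C hZ hP NH A₀ hA₀ hA₀').Hodot)
    (Ψ : C.category ≌ C.category) :
    ∃ hh : Thm44Hyp (mkOfConnectedTemperoid X C hZ hP NH A₀ hA₀ hA₀') (mkOfConnectedTemperoid X C hZ hP NH A₀ hA₀ hA₀'),
      hh.Ψ = Ψ ∧ hh.PreservesFrobeniusStructure ∧ hh.HodotCompatible ∧ hh.GaloisCompatible ∧ hh.PreservesAmple ∧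
      Thm44_i hh ∧
      ∀ (hF₁ hF₂ : PreFrobenioid.IsFrobenioid C.toElem) (h3 : hh.PreservesFrobeniusStructure)
        (_ : hh.PreservesNHSaturatedBsFld),
        Thm44_ii hh (hh.psiModel hF₁ hF₂ h3) ∧ Thm44_iii hh (hh.psiModel hF₁ hF₂ h3) ∧
          hh.PreservesNthRoots (hh.psiModel hF₁ hF₂ h3) (fun φ f => C.pullFracModel φ f) (fun φ f => C.pullFracModel φ f) :=
  exists_thm44_self_mkOfConnectedTemperoid X C hZ hP NH A₀ hA₀ hA₀' (DivisorMonoids.ofGaloisActionCoset_ofRlfZ_hBinj GA hC hpf)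
    hnd hshape hc Ψ

end Coset

/-! ### §2 Over the connected model (`K : Type (u+1)`) -/

section Connected

variable {Z : LogDivisorModel.{u}} {G : Type u} [Group G] (GA : Z.GaloisAction G) (hC : Z.CuspLaws)
  (hpf : ∀ Y : ((isConnectedGSet (G := G)).FullSubcategory)ᵒᵖ,
    IsPerfFactorial ((DivisorMonoids.ofGaloisActionConnected GA hC).Φ₀.obj Y))
  {K : Type (u + 1)} [Field K] (X : SemiGraphs.TemperedArithmeticGroup.{u + 1} K)
  {IsRational IsStrictlyRational : ((ConnectedPart (BTemp X.Pi))ᵒᵖ ⥤ CommMonCat.{u}) → Prop}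
  (C : TemperedFrobenioid (RealifiedDivisorMonoids.ofRlfZ (DivisorMonoids.ofGaloisActionConnected GA hC) hpf)
    (ConnectedPart (BTemp X.Pi)) (treeCatVocab (ConnectedPart (BTemp X.Pi)) IsRational IsStrictlyRational))
  (hZ : C.monoidType = MonoidType.Z) (hP : ∀ A : (ConnectedPart (BTemp X.Pi))ᵒᵖ, IsPerfect (C.Φ.carrier A))
  (NH : Subgroup (Field.absoluteGaloisGroup K) → C.category → ℕ+ → Prop) (A₀ : C.category)
  (hA₀ : PreFrobenioid.IsFrobeniusTrivial C.toElem A₀) (hA₀' : SemiGraphs.IsGaloisObj A₀.base.obj)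

/-- **Prop 5.1's pin at the connected-model constructed data**: `Thm44Hyp S S` with underlying `Ψ` EXISTS for every
self-equivalence ⇐ {`hnd`, `hshape`, `hc`} (`hBinj` := `ofGaloisActionConnected_ofRlfZ_hBinj`).
[cite: MochizukiEtTh2009, Prop 5.1 p.323 (PDF p.97)] -/
theorem exists_thm44Hyp_self_ofGaloisActionConnected
    (hnd : ∀ (A : (ConnectedPart (BTemp X.Pi))ᵒᵖ) (f : A ⟶ A), treeMonoidVocab.{u}.IsNonDilating (C.Φ.carrier A) (C.Φ.pull f))
    (hshape : C.base.Full ∧ C.base.Faithful ∧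
      ∃ 𝒟 : (isConnectedGSet (G := G)).FullSubcategory, ∀ Y : (isConnectedGSet (G := G)).FullSubcategory,
        (∃ A : ConnectedPart (BTemp X.Pi), Nonempty (C.base.obj A ≅ Y)) ↔ Nonempty (Y ⟶ 𝒟))
    (hc : IsTopCharacteristic X.Pi (mkOfConnectedTemperoid X C hZ hP NH A₀ hA₀ hA₀').Hodot)
    (Ψ : C.category ≌ C.category) :
    ∃ hh : Thm44Hyp (mkOfConnectedTemperoid X C hZ hP NH A₀ hA₀ hA₀') (mkOfConnectedTemperoid X C hZ hP NH A₀ hA₀ hA₀'),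
      hh.Ψ = Ψ :=
  exists_thm44Hyp_self_of_hBinj X C hZ hP NH A₀ hA₀ hA₀' (DivisorMonoids.ofGaloisActionConnected_ofRlfZ_hBinj GA hC hpf) hnd
    hshape hc Ψ

/-- **[EtTh] Thm 4.4 for EVERY self-equivalence at the connected-model constructed data** — residual {`hnd`, `hshape`, `hc`,
T44-L15b}. [cite: MochizukiEtTh2009, Thm 4.4 p.319–320 (PDF pp.93–94)] -/
theorem exists_thm44_self_mkOfConnectedTemperoid_ofGaloisActionConnected
    (hnd : ∀ (A : (ConnectedPart (BTemp X.Pi))ᵒᵖ) (f : A ⟶ A), treeMonoidVocab.{u}.IsNonDilating (C.Φ.carrier A) (C.Φ.pull f))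
    (hshape : C.base.Full ∧ C.base.Faithful ∧
      ∃ 𝒟 : (isConnectedGSet (G := G)).FullSubcategory, ∀ Y : (isConnectedGSet (G := G)).FullSubcategory,
        (∃ A : ConnectedPart (BTemp X.Pi), Nonempty (C.base.obj A ≅ Y)) ↔ Nonempty (Y ⟶ 𝒟))
    (hc : IsTopCharacteristic X.Pi (mkOfConnectedTemperoid X C hZ hP NH A₀ hA₀ hA₀').Hodot)
    (Ψ : C.category ≌ C.category) :
    ∃ hh : Thm44Hyp (mkOfConnectedTemperoid X C hZ hP NH A₀ hA₀ hA₀') (mkOfConnectedTemperoid X C hZ hP NH A₀ hA₀ hA₀'),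
      hh.Ψ = Ψ ∧ hh.PreservesFrobeniusStructure ∧ hh.HodotCompatible ∧ hh.GaloisCompatible ∧ hh.PreservesAmple ∧
      Thm44_i hh ∧
      ∀ (hF₁ hF₂ : PreFrobenioid.IsFrobenioid C.toElem) (h3 : hh.PreservesFrobeniusStructure)
        (_ : hh.PreservesNHSaturatedBsFld),
        Thm44_ii hh (hh.psiModel hF₁ hF₂ h3) ∧ Thm44_iii hh (hh.psiModel hF₁ hF₂ h3) ∧
          hh.PreservesNthRoots (hh.psiModel hF₁ hF₂ h3) (fun φ f => C.pullFracModel φ f) (fun φ f => C.pullFracModel φ f) :=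
  exists_thm44_self_mkOfConnectedTemperoid X C hZ hP NH A₀ hA₀ hA₀'
    (DivisorMonoids.ofGaloisActionConnected_ofRlfZ_hBinj GA hC hpf) hnd hshape hc Ψ

end Connected

/-! ## APPENDIX (v2, append-only): `hshape` DISCHARGED too when the reference functor is an equivalence
(abc-iut-w4-d008's `Sec4BaseShapeOfConnectedTemperoid.lean`, R332) — residual {`hnd`, `hc`} (+ T44-L15b) -/

section CosetEquiv

variable {Z : LogDivisorModel.{u}} {G : Type u} [Group G] (GA : Z.GaloisAction G) (hC : Z.CuspLaws)
  (hpf : ∀ Y : (InducedCategory (Action (Type u) G) (cosetGSet G))ᵒᵖ,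
    IsPerfFactorial ((DivisorMonoids.ofGaloisActionCoset GA hC).Φ₀.obj Y))
  {K : Type u} [Field K] (X : SemiGraphs.TemperedArithmeticGroup.{u} K)
  {IsRational IsStrictlyRational : ((ConnectedPart (BTemp X.Pi))ᵒᵖ ⥤ CommMonCat.{u}) → Prop}
  (C : TemperedFrobenioid (RealifiedDivisorMonoids.ofRlfZ (DivisorMonoids.ofGaloisActionCoset GA hC) hpf)
    (ConnectedPart (BTemp X.Pi)) (treeCatVocab (ConnectedPart (BTemp X.Pi)) IsRational IsStrictlyRational))
  (hZ : C.monoidType = MonoidType.Z) (hP : ∀ A : (ConnectedPart (BTemp X.Pi))ᵒᵖ, IsPerfect (C.Φ.carrier A))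
  (NH : Subgroup (Field.absoluteGaloisGroup K) → C.category → ℕ+ → Prop) (A₀ : C.category)
  (hA₀ : PreFrobenioid.IsFrobeniusTrivial C.toElem A₀) (hA₀' : SemiGraphs.IsGaloisObj A₀.base.obj)

/-- **Prop 5.1's pin at the coset-model constructed data when the reference functor `B^temp(Π^tp_X)⁰ ⥤ D₀` is an
EQUIVALENCE** (print §5 p.322: `D = D₀`): for EVERY self-equivalence `Ψ`, `Thm44Hyp S S` with underlying `Ψ` EXISTS
⇐ {`hnd`, `hc`} — `hBinj` by the coset-model theorem, `hshape` by abc-iut-w4-d008's `hshape_of_base_isEquivalence`.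
[cite: MochizukiEtTh2009, Prop 5.1 p.323 (PDF p.97)] -/
theorem exists_thm44Hyp_self_of_base_isEquivalence_ofGaloisActionCoset [C.base.IsEquivalence]
    (hnd : ∀ (A : (ConnectedPart (BTemp X.Pi))ᵒᵖ) (f : A ⟶ A), treeMonoidVocab.{u}.IsNonDilating (C.Φ.carrier A) (C.Φ.pull f))
    (hc : IsTopCharacteristic X.Pi (mkOfConnectedTemperoid X C hZ hP NH A₀ hA₀ hA₀').Hodot)
    (Ψ : C.category ≌ C.category) :
    ∃ hh : Thm44Hyp (mkOfConnectedTemperoid X C hZ hP NH A₀ hA₀ hA₀') (mkOfConnectedTemperoid X C hZ hP NH A₀ hA₀ hA₀'),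
      hh.Ψ = Ψ :=
  exists_thm44Hyp_self_of_base_isEquivalence X C hZ hP NH A₀ hA₀ hA₀'
    (DivisorMonoids.ofGaloisActionCoset_ofRlfZ_hBinj GA hC hpf) hnd hc Ψ

/-- **[EtTh] Thm 4.4 for EVERY self-equivalence at the coset-model constructed data with reference functor an
equivalence**: a package `hh : Thm44Hyp S S` with `hh.Ψ = Ψ` exists and satisfies T44-L03, T44-L09, T44-L09c, T44-L08,
Thm 4.4 (i), and — given T44-L15b and any proofs for the ψ-slot — Thm 4.4 (ii) ∧ (iii) ∧ (`N`-th roots); residual =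
{`hnd`, `hc`, T44-L15b} (+ the constructor parameter `hpf`). [cite: MochizukiEtTh2009, Thm 4.4 p.319–320 (PDF pp.93–94)] -/
theorem exists_thm44_self_of_base_isEquivalence_ofGaloisActionCoset [C.base.IsEquivalence]
    (hnd : ∀ (A : (ConnectedPart (BTemp X.Pi))ᵒᵖ) (f : A ⟶ A), treeMonoidVocab.{u}.IsNonDilating (C.Φ.carrier A) (C.Φ.pull f))
    (hc : IsTopCharacteristic X.Pi (mkOfConnectedTemperoid X C hZ hP NH A₀ hA₀ hA₀').Hodot)
    (Ψ : C.category ≌ C.category) :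
    ∃ hh : Thm44Hyp (mkOfConnectedTemperoid X C hZ hP NH A₀ hA₀ hA₀') (mkOfConnectedTemperoid X C hZ hP NH A₀ hA₀ hA₀'),
      hh.Ψ = Ψ ∧ hh.PreservesFrobeniusStructure ∧ hh.HodotCompatible ∧ hh.GaloisCompatible ∧ hh.PreservesAmple ∧
      Thm44_i hh ∧
      ∀ (hF₁ hF₂ : PreFrobenioid.IsFrobenioid C.toElem) (h3 : hh.PreservesFrobeniusStructure)
        (_ : hh.PreservesNHSaturatedBsFld),
        Thm44_ii hh (hh.psiModel hF₁ hF₂ h3) ∧ Thm44_iii hh (hh.psiModel hF₁ hF₂ h3) ∧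
          hh.PreservesNthRoots (hh.psiModel hF₁ hF₂ h3) (fun φ f => C.pullFracModel φ f) (fun φ f => C.pullFracModel φ f) :=
  exists_thm44_self_of_base_isEquivalence X C hZ hP NH A₀ hA₀ hA₀'
    (DivisorMonoids.ofGaloisActionCoset_ofRlfZ_hBinj GA hC hpf) hnd hc Ψ

end CosetEquiv

section ConnectedEquiv

variable {Z : LogDivisorModel.{u}} {G : Type u} [Group G] (GA : Z.GaloisAction G) (hC : Z.CuspLaws)
  (hpf : ∀ Y : ((isConnectedGSet (G := G)).FullSubcategory)ᵒᵖ,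
    IsPerfFactorial ((DivisorMonoids.ofGaloisActionConnected GA hC).Φ₀.obj Y))
  {K : Type (u + 1)} [Field K] (X : SemiGraphs.TemperedArithmeticGroup.{u + 1} K)
  {IsRational IsStrictlyRational : ((ConnectedPart (BTemp X.Pi))ᵒᵖ ⥤ CommMonCat.{u}) → Prop}
  (C : TemperedFrobenioid (RealifiedDivisorMonoids.ofRlfZ (DivisorMonoids.ofGaloisActionConnected GA hC) hpf)
    (ConnectedPart (BTemp X.Pi)) (treeCatVocab (ConnectedPart (BTemp X.Pi)) IsRational IsStrictlyRational))
  (hZ : C.monoidType = MonoidType.Z) (hP : ∀ A : (ConnectedPart (BTemp X.Pi))ᵒᵖ, IsPerfect (C.Φ.carrier A))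
  (NH : Subgroup (Field.absoluteGaloisGroup K) → C.category → ℕ+ → Prop) (A₀ : C.category)
  (hA₀ : PreFrobenioid.IsFrobeniusTrivial C.toElem A₀) (hA₀' : SemiGraphs.IsGaloisObj A₀.base.obj)

/-- **Prop 5.1's pin at the connected-model constructed data with reference functor an equivalence** — residual
{`hnd`, `hc`}. [cite: MochizukiEtTh2009, Prop 5.1 p.323 (PDF p.97)] -/
theorem exists_thm44Hyp_self_of_base_isEquivalence_ofGaloisActionConnected [C.base.IsEquivalence]
    (hnd : ∀ (A : (ConnectedPart (BTemp X.Pi))ᵒᵖ) (f : A ⟶ A), treeMonoidVocab.{u}.IsNonDilating (C.Φ.carrier A) (C.Φ.pull f))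
    (hc : IsTopCharacteristic X.Pi (mkOfConnectedTemperoid X C hZ hP NH A₀ hA₀ hA₀').Hodot)
    (Ψ : C.category ≌ C.category) :
    ∃ hh : Thm44Hyp (mkOfConnectedTemperoid X C hZ hP NH A₀ hA₀ hA₀') (mkOfConnectedTemperoid X C hZ hP NH A₀ hA₀ hA₀'),
      hh.Ψ = Ψ :=
  exists_thm44Hyp_self_of_base_isEquivalence X C hZ hP NH A₀ hA₀ hA₀'
    (DivisorMonoids.ofGaloisActionConnected_ofRlfZ_hBinj GA hC hpf) hnd hc Ψ

/-- **[EtTh] Thm 4.4 for EVERY self-equivalence at the connected-model constructed data with reference functor an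
equivalence** — residual {`hnd`, `hc`, T44-L15b}. [cite: MochizukiEtTh2009, Thm 4.4 p.319–320 (PDF pp.93–94)] -/
theorem exists_thm44_self_of_base_isEquivalence_ofGaloisActionConnected [C.base.IsEquivalence]
    (hnd : ∀ (A : (ConnectedPart (BTemp X.Pi))ᵒᵖ) (f : A ⟶ A), treeMonoidVocab.{u}.IsNonDilating (C.Φ.carrier A) (C.Φ.pull f))
    (hc : IsTopCharacteristic X.Pi (mkOfConnectedTemperoid X C hZ hP NH A₀ hA₀ hA₀').Hodot)
    (Ψ : C.category ≌ C.category) :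
    ∃ hh : Thm44Hyp (mkOfConnectedTemperoid X C hZ hP NH A₀ hA₀ hA₀') (mkOfConnectedTemperoid X C hZ hP NH A₀ hA₀ hA₀'),
      hh.Ψ = Ψ ∧ hh.PreservesFrobeniusStructure ∧ hh.HodotCompatible ∧ hh.GaloisCompatible ∧ hh.PreservesAmple ∧
      Thm44_i hh ∧
      ∀ (hF₁ hF₂ : PreFrobenioid.IsFrobenioid C.toElem) (h3 : hh.PreservesFrobeniusStructure)
        (_ : hh.PreservesNHSaturatedBsFld),
        Thm44_ii hh (hh.psiModel hF₁ hF₂ h3) ∧ Thm44_iii hh (hh.psiModel hF₁ hF₂ h3) ∧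
          hh.PreservesNthRoots (hh.psiModel hF₁ hF₂ h3) (fun φ f => C.pullFracModel φ f) (fun φ f => C.pullFracModel φ f) :=
  exists_thm44_self_of_base_isEquivalence X C hZ hP NH A₀ hA₀ hA₀'
    (DivisorMonoids.ofGaloisActionConnected_ofRlfZ_hBinj GA hC hpf) hnd hc Ψ

end ConnectedEquiv

end BiKummerSetting

end Literature.AnabelianGeometry.EtaleTheta

end
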